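/-
Copyright (c) 2026 the pub-hodgecm-mathlib formalisation cell (harness21).  Prover seat hodgecm-mathlib-B-p04 (g30), floor 0, programme P5
(Alb-CM), row R2′-J (desk F0P5-plan (g4), 2026-08-31).  KERNEL module: THEOREMS ONLY (no definition, no named fact, no `sorry`, no instance,
no notation).
-/
import Literature.NumberTheory.Automorphic.Liu2021.CheckOfChiLocalPlace
import Literature.NumberTheory.Automorphic.Liu2021.LemD1FamilyOfPlace
import Literature.NumberTheory.Automorphic.Liu2021.LemD1AsPrintedIndexedNonVacuityTameTwistCM
import HarnessLib

/-!
# The companion label `Λᶜ·χ̌` read at a finite place `v` IS [Liu2021, Lem. D.1 (4)]'s local twist «`μᶜ χ̌`» of `Λ_v`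

Topic `NumberTheory/Automorphic/Liu2021`; namespace `Literature.NumberTheory.Automorphic.Liu2021.CheckOfChi`.  KERNEL: theorems only.  Cell
hodgecm-mathlib FLOOR 0, programme P5, row R2′-J (the `TODO(valueAtUniformizer_checkOfChi)` of ★ `CheckOfChi.lean` :23–25, done for all `w ∣ v`
at once on `E_v = L ⊗_{L⁺} L⁺_v = Π_{w ∣ v} L_w`).

[Liu2021, Lem. D.1 (4)] (App. D, p. 126) compares, AT A NON-ARCHIMEDEAN PLACE, the local oscillator data `(μ, ε, χ)` and `(μᶜχ̌, ε′, χ)`, where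
(l. 5224) «`χ̌(x) = χ(x/xᶜ)`» and «`μᶜ := μ ∘ c`»; the tree types the LOCAL twist as ★ `LemD1.muTwist μ χ = ⟨(μ ∘ c) · S.check χ, …⟩` over
the standing data `S = LemD1OfPlace.standingData … v`, and the GLOBAL companion label of the θ-type family as the Hecke character
`Λ′ = galConj 𝔠 Λ · checkOfChi hcc χ` (★ `CheckOfChiCompanionCharacter`; R1∕R2′ of the P5 pay-down line).  This file proves the JUNCTION the
per-place rows consume — the Step-2 local component ★ `LocalSplitting.localMu L Λ′ v` of the companion IS `muTwist` of the local component of `Λ`: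

* `localMu_galConj_apply` — **`(Λ ∘ 𝔠)_v(x) = Λ_v((𝔠 ⊗ 1) x)`** at EVERY finite place `v` of `L⁺` (split or not): `𝔠 • ⟨x_w⟩_w = ⟨𝔠_w x_w⟩_{𝔠w}`
  (★ `algEquiv_smul_localUnits`) and re-indexing `w ↦ 𝔠 • w` of `Π_{w ∣ v}` (the involution `𝔠` of the places above `v`);
* `localMu_checkOfChi_eq_check` — **`(χ̌)_v = S.check (χ_v ∘ θ)`**: ★ `check_localCharOfCenter_comp_theta` read through ★ `localMu_apply`;
* `localMu_galConj_mul_checkOfChi_apply` — the pointwise junction **`Λ′_v(x) = Λ_v(xᶜ) · χ_v(x ∕ xᶜ)`**;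
* `muOf_localMu_eq_muTwist` — the same as an identity in `LemD1.MuSet S_v`: **`muOf (localMu L Λ′ v) = LemD1.muTwist (muOf (localMu L Λ v)) (chiOf χ_v)`**
  (`χ_v = localCharOfCenter … J₁ … χ v`, any carried proofs), the shape F0-typ3's θ-package member currency `μOf i v := localMu L θ_i v` consumes.

HONEST SCOPE: identities between characters; nothing of [Liu2021, Lem. D.1] is asserted; count-neutral.  HC_CM is proved only modulo the printed
citations — the 2 remaining named inputs (hLiu418, h413) — until rung 0 closes.

## References
* [Liu2021] Y. Liu, *Fourier–Jacobi cycles and arithmetic relative trace formula*, Camb. J. Math. 9 (2021) = arXiv:2102.11518: Def. 4.11 (l. 2086),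
  App. D §D.1 Step 2 (l. 5219), l. 5224 (`χ̌`), Lem. D.1 (2), (4) (l. 5231, 5235; p. 126).
* [CasselsFrohlichANT1967] J. W. S. Cassels, A. Fröhlich (eds.), *Algebraic Number Theory* (1967), Ch. II §10–§11 (`L ⊗_K K_v = Π_{w∣v} L_w`),
  Ch. VII §1.1 (Galois action on local components).
-/

set_option autoImplicit false

noncomputable section

open NumberField IsDedekindDomain
open scoped Classical Matrix

namespace Literature.NumberTheory.Automorphic.Liu2021.CheckOfChi

open Literature.NumberTheory.GaloisRepresentations
open Literature.NumberTheory.Automorphic.UnitaryGroup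
open Literature.NumberTheory.Automorphic.Liu2021.Def411WeilCarriers
open Literature.NumberTheory.Automorphic.Liu2021.LemD1OfPlace
open Literature.NumberTheory.Automorphic.Liu2021.LemD1IndexedNonVacuityTameTwistCM (localMu_mul)
open Literature.NumberTheory.GelbartRogawski1991.UnitaryDualPair.LocalSplitting
open Literature.RepresentationTheory.Liu2021

variable (L : Type) [Field L] [NumberField L] [IsCMField L]

/-! ## §1 `(Λ ∘ 𝔠)_v = Λ_v ∘ (𝔠 ⊗ 1)` at every finite place -/

/-- transport of a component along an equality of places above `v` (`subst; rfl`). [cite: CasselsFrohlichANT1967, Ch. VII §1.1] -/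
private theorem galAdicCompletionMap_apply_congr {v : HeightOneSpectrum (𝓞 ↥(maximalRealSubfield L))} (w₁ w₂ : UnitaryGroup.PlacesOver L v) (e : w₁ = w₂)
    {w' : HeightOneSpectrum (𝓞 L)} (h₁ : IsCMField.complexConj L • w₁.1 = w') (h₂ : IsCMField.complexConj L • w₂.1 = w') (y : UnitaryGroup.LocalRing L v) :
    galAdicCompletionMap (L := L) (IsCMField.complexConj L) h₁ (y w₁) = galAdicCompletionMap (L := L) (IsCMField.complexConj L) h₂ (y w₂) := by
  subst e
  rfl

/-- **`(Λ ∘ 𝔠)_v(x) = Λ_v((𝔠 ⊗ 1) x)`** for every Hecke character `Λ` of the CM field `L`, every finite place `v` of `L⁺` and `x ∈ E_vˣ`,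
`E_v = Π_{w ∣ v} L_w` (★ `localMu`: `Λ_v(x) = Π_{w ∣ v} Λ(⟨x_w⟩_w)`; `𝔠 • ⟨u⟩_w = ⟨𝔠_w u⟩_{𝔠w}`, ★ `algEquiv_smul_localUnits`; the places above
`v` are permuted by the involution `w ↦ 𝔠 • w`).  Liu's «`μᶜ := μ ∘ c`» [Lem. D.1 (2)] for the local component of a GLOBAL `Λ ∘ 𝔠`.
[cite: Liu2021, App. D Lem. D.1 (2) (l. 5231); Def. 4.11 (l. 2086)] [cite: CasselsFrohlichANT1967, Ch. VII §1.1] -/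
theorem localMu_galConj_apply (Λ : HeckeCharacter L) (v : HeightOneSpectrum (𝓞 ↥(maximalRealSubfield L))) (x : (UnitaryGroup.LocalRing L v)ˣ) :
    localMu L (HeckeCharacter.galConj (IsCMField.complexConj L) Λ) v x =
      localMu L Λ v (Units.map (UnitaryGroup.conjLocal L (IsCMField.complexConj L) v : UnitaryGroup.LocalRing L v →* UnitaryGroup.LocalRing L v) x) := by
  have hcc : IsCMField.complexConj L * IsCMField.complexConj L = 1 := by
    ext y
    exact IsCMField.complexConj_apply_apply L y
  have hmem : ∀ w : UnitaryGroup.PlacesOver L v, (IsCMField.complexConj L • w.1).under (𝓞 ↥(maximalRealSubfield L)) = v := fun w => by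
    rw [HeightOneSpectrum.under_algEquiv_smul]
    exact w.2
  rw [localMu_apply, localMu_apply]
  simp only [HeckeCharacter.galConj_apply, algEquiv_smul_localUnits]
  refine Fintype.prod_bijective (fun w : UnitaryGroup.PlacesOver L v => (⟨IsCMField.complexConj L • w.1, hmem w⟩ : UnitaryGroup.PlacesOver L v))
    (Function.Involutive.bijective fun w => Subtype.ext (by
      show IsCMField.complexConj L • IsCMField.complexConj L • w.1 = w.1
      rw [smul_smul, hcc, one_smul])) _ _ fun w => ?_
  -- the `w`-th factors agree: `⟨𝔠_w x_w⟩_{𝔠w}` on both sides (the right side reads the `𝔠 • w`-component of `(𝔠 ⊗ 1) x`)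
  congr 2
  refine Units.ext ?_
  simp only [galAdicCompletionUnitsEquiv, Units.coe_mapEquiv, Units.coe_map,
    MonoidHom.coe_coe, Pi.evalMonoidHom_apply, UnitaryGroup.conjLocal_apply]
  exact galAdicCompletionMap_apply_congr L w
    ⟨(IsCMField.complexConj L)⁻¹ • IsCMField.complexConj L • w.1,
      UnitaryGroup.under_inv_smul_eq (IsCMField.complexConj L) (⟨IsCMField.complexConj L • w.1, hmem w⟩ : UnitaryGroup.PlacesOver L v)⟩
    (Subtype.ext (inv_smul_smul (IsCMField.complexConj L) w.1).symm) rfl (smul_inv_smul (IsCMField.complexConj L) _)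
    (x : UnitaryGroup.LocalRing L v)

/-! ## §2 `(χ̌)_v = S.check (χ_v ∘ θ)` and the junction `Λ′_v = (Λ ∘ 𝔠)_v · (χ̌)_v = muTwist` -/

section Place

variable (hcc : IsCMField.complexConj L * IsCMField.complexConj L = 1) (χ : Chi ↥(maximalRealSubfield L) L (IsCMField.complexConj L))
  {N : ℕ} {J : Matrix (Fin N) (Fin N) L} {v : HeightOneSpectrum (𝓞 ↥(maximalRealSubfield L))} {δ : L}
  (hcδ : IsCMField.complexConj L δ = -δ) (hδ : δ ≠ 0) (hN : 2 ≤ N) (hJh : (J.map (IsCMField.complexConj L))ᵀ = J) (hJdet : J.det ≠ 0)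
  {J₁ : Matrix (Fin 1) (Fin 1) L} (hJ₁ : J₁ 0 0 ≠ 0)

/-- **`(χ̌)_v(x) = S.check (χ_v ∘ θ) x`**: the local component at `v` of the GLOBAL `χ̌ = checkOfChi hcc χ` is the LOCAL `χ̌` of
[Liu2021, §D.1 l. 5224] of `χ_v = localCharOfCenter … χ v` over the standing data at `v` (★ `check_localCharOfCenter_comp_theta` + ★ `localMu_apply`).
[cite: Liu2021, App. D §D.1 (l. 5221–5224); Lem. D.1 (4) (l. 5235)] -/
theorem localMu_checkOfChi_eq_check (x : (UnitaryGroup.LocalRing L v)ˣ) :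
    localMu L (HeckeCharacter.checkOfChi hcc χ) v x =
      (standingData L v (IsCMField.complexConj L) N J hcδ hδ hN hJh hJdet).check
        ((localCharOfCenter ↥(maximalRealSubfield L) L (IsCMField.complexConj L) J₁ hJ₁
          (χ : UnitaryGroup.finAdelicOne ↥(maximalRealSubfield L) L (IsCMField.complexConj L) →* ℂˣ) v).comp
          (theta L v (IsCMField.complexConj L) N J hcδ hδ hN hJh hJdet J₁)) x := by
  rw [check_localCharOfCenter_comp_theta hcc χ hcδ hδ hN hJh hJdet hJ₁, localMu_apply]
  rfl

/-- **the pointwise junction `Λ′_v(x) = Λ_v(xᶜ) · χ_v(x ∕ xᶜ)`** for the companion label `Λ′ = (Λ ∘ 𝔠) · χ̌` of [Liu2021, Lem. D.1 (4)] «`μ′ = μᶜ χ̌`»: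
the local component of the GLOBAL companion at `v` is the printed LOCAL twist of the local component of `Λ`.
[cite: Liu2021, App. D Lem. D.1 (4) (l. 5235, p. 126); §D.1 (l. 5224)] [cite: CasselsFrohlichANT1967, Ch. VII §1.1] -/
theorem localMu_galConj_mul_checkOfChi_apply (Λ : HeckeCharacter L) (x : (UnitaryGroup.LocalRing L v)ˣ) :
    localMu L (HeckeCharacter.galConj (IsCMField.complexConj L) Λ * HeckeCharacter.checkOfChi hcc χ) v x =
      localMu L Λ v (Units.map (UnitaryGroup.conjLocal L (IsCMField.complexConj L) v : UnitaryGroup.LocalRing L v →* UnitaryGroup.LocalRing L v) x) *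
        (standingData L v (IsCMField.complexConj L) N J hcδ hδ hN hJh hJdet).check
          ((localCharOfCenter ↥(maximalRealSubfield L) L (IsCMField.complexConj L) J₁ hJ₁
            (χ : UnitaryGroup.finAdelicOne ↥(maximalRealSubfield L) L (IsCMField.complexConj L) →* ℂˣ) v).comp
            (theta L v (IsCMField.complexConj L) N J hcδ hδ hN hJh hJdet J₁)) x := by
  rw [localMu_mul, MonoidHom.mul_apply, localMu_galConj_apply, localMu_checkOfChi_eq_check L hcc χ hcδ hδ hN hJh hJdet hJ₁]

/-- **R2′-J, `MuSet` form: the Step-2 local datum of the companion label IS `LemD1.muTwist` of the local datum of `Λ`** —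
`muOf (localMu L Λ′ v) = muTwist (muOf (localMu L Λ v)) (chiOf (localCharOfCenter … J₁ … χ v))` in `LemD1.MuSet (standingData … v)`, for ANY
`Λ′ = (Λ ∘ 𝔠) · χ̌` and any carried Step-2∕Step-3 proofs (the θ-package member currency `μOf i v := localMu L θ_i v`).  This is the local half of
[Liu2021, Lem. D.1 (4)] «`ω(μ,ε,χ) ≅ ω(μᶜχ̌, ε′, χ)`» needed to read the global companion relabel `λ ↦ λᶜ·χ̌` member-wise.
[cite: Liu2021, App. D Lem. D.1 (4) (l. 5235, p. 126); §D.1 Steps 2–3 (l. 5219–5224)] -/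
theorem muOf_localMu_eq_muTwist [IsModuleTopology (v.adicCompletion ↥(maximalRealSubfield L)) (UnitaryGroup.LocalRing L v)]
    (Λ Λ' : HeckeCharacter L)
    (hΛ' : Λ' = HeckeCharacter.galConj (IsCMField.complexConj L) Λ * HeckeCharacter.checkOfChi hcc χ)
    (h₁ : ∀ x, ‖((localMu L Λ' v x : ℂˣ) : ℂ)‖ = 1) (h₂ : Continuous fun x => ((localMu L Λ' v x : ℂˣ) : ℂ))
    (h₃ : ∀ a : (v.adicCompletion ↥(maximalRealSubfield L))ˣ,
      localMu L Λ' v (Units.map (algebraMap (v.adicCompletion ↥(maximalRealSubfield L)) (UnitaryGroup.LocalRing L v)).toMonoidHom a) = 1 ↔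
        ∃ x : (UnitaryGroup.LocalRing L v)ˣ, (x : UnitaryGroup.LocalRing L v) * UnitaryGroup.conjLocal L (IsCMField.complexConj L) v x =
          algebraMap (v.adicCompletion ↥(maximalRealSubfield L)) (UnitaryGroup.LocalRing L v) a)
    (h₁' : ∀ x, ‖((localMu L Λ v x : ℂˣ) : ℂ)‖ = 1) (h₂' : Continuous fun x => ((localMu L Λ v x : ℂˣ) : ℂ))
    (h₃' : ∀ a : (v.adicCompletion ↥(maximalRealSubfield L))ˣ,
      localMu L Λ v (Units.map (algebraMap (v.adicCompletion ↥(maximalRealSubfield L)) (UnitaryGroup.LocalRing L v)).toMonoidHom a) = 1 ↔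
        ∃ x : (UnitaryGroup.LocalRing L v)ˣ, (x : UnitaryGroup.LocalRing L v) * UnitaryGroup.conjLocal L (IsCMField.complexConj L) v x =
          algebraMap (v.adicCompletion ↥(maximalRealSubfield L)) (UnitaryGroup.LocalRing L v) a)
    (hχn : ∀ h, ‖((localCharOfCenter ↥(maximalRealSubfield L) L (IsCMField.complexConj L) J₁ hJ₁
      (χ : UnitaryGroup.finAdelicOne ↥(maximalRealSubfield L) L (IsCMField.complexConj L) →* ℂˣ) v h : ℂˣ) : ℂ)‖ = 1)
    (hχc : Continuous fun h => ((localCharOfCenter ↥(maximalRealSubfield L) L (IsCMField.complexConj L) J₁ hJ₁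
      (χ : UnitaryGroup.finAdelicOne ↥(maximalRealSubfield L) L (IsCMField.complexConj L) →* ℂˣ) v h : ℂˣ) : ℂ)) :
    muOf L v (IsCMField.complexConj L) N J hcδ hδ hN hJh hJdet (localMu L Λ' v) h₁ h₂ h₃ =
      LemD1.muTwist (muOf L v (IsCMField.complexConj L) N J hcδ hδ hN hJh hJdet (localMu L Λ v) h₁' h₂' h₃')
        (chiOf L v (IsCMField.complexConj L) N J hcδ hδ hN hJh hJdet J₁
          (localCharOfCenter ↥(maximalRealSubfield L) L (IsCMField.complexConj L) J₁ hJ₁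
            (χ : UnitaryGroup.finAdelicOne ↥(maximalRealSubfield L) L (IsCMField.complexConj L) →* ℂˣ) v) hχn hχc) := by
  subst hΛ'
  apply Subtype.ext
  refine MonoidHom.ext fun x => ?_
  change localMu L (HeckeCharacter.galConj (IsCMField.complexConj L) Λ * HeckeCharacter.checkOfChi hcc χ) v x =
    localMu L Λ v (Units.map ((standingData L v (IsCMField.complexConj L) N J hcδ hδ hN hJh hJdet).σ : UnitaryGroup.LocalRing L v →* UnitaryGroup.LocalRing L v) x) *
      (standingData L v (IsCMField.complexConj L) N J hcδ hδ hN hJh hJdet).check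
        ((localCharOfCenter ↥(maximalRealSubfield L) L (IsCMField.complexConj L) J₁ hJ₁
          (χ : UnitaryGroup.finAdelicOne ↥(maximalRealSubfield L) L (IsCMField.complexConj L) →* ℂˣ) v).comp
          (theta L v (IsCMField.complexConj L) N J hcδ hδ hN hJh hJdet J₁)) x
  rw [localMu_galConj_mul_checkOfChi_apply L hcc χ hcδ hδ hN hJh hJdet hJ₁]
  rfl

end Place

end Literature.NumberTheory.Automorphic.Liu2021.CheckOfChi

end
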